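import Summits.CriticalPhenomena.SAWScalingLimit.Theorems.SAWDefectDecoherencePolygonParitySqueezeDefs
import Summits.CriticalPhenomena.SAWScalingLimit.Theorems.SAWDefectDecoherenceBoundaryClosureRGateTraceDartPhase
import Summits.CriticalPhenomena.SAWScalingLimit.Theorems.SAWDefectDecoherenceBoundaryClosureRGateMassLaws
import Summits.CriticalPhenomena.SAWScalingLimit.Theorems.SAWDefectDecoherenceBoundaryClosureRLocalL1StarInversion
import Summits.CriticalPhenomena.SAWScalingLimit.Theorems.SAWDevelopingMapObservableToSLERestrictionCocycleHelpersFloor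
import Summits.CriticalPhenomena.SAWScalingLimit.Theorems.DefectDecoherence.Negative.WallExitTwoPoint
import Literature.Barriers.CriticalPhenomena.ParafermionicHalfCauchyRiemann
import HarnessLib

/-!
# Gate `∂̄`-limit, III: floor darts of the gate row
(crux `BoundaryClosureR`, stmt-CriticalPhenomena-14004, line `polygon-parity-squeeze`, registered
stub `stub_gateDbarLimit`, mechanism (C))

Lattice geometry of the gate row of a family pinned at `c` (exact half-lattice `{v | m ≤ v.1 1}` on
`B(c, ρ)`), for the boundary term of the gate identity (`…GateDbarBoundary.lean`): the floor dart of
column `k` points straight down, `mid − c_v = c/2` with `3c = −i√3` (`hexMidpoint_floorDart_sub_center`,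
`three_mul_vecC`); floor mid-edges of one row are horizontal translates, so the window of columns
whose scaled dart midpoint lies in a ball is an interval (`mem_window_between`) along which the floor
is flat and pinned (`floor_between`, the hypotheses of `GateTrace.dartRatio_eq_massRatio`); and a dart
sum supported in the quarter ball is a sum over the window of columns (`dartSum_eq_finsum_window`, via
`GateMass.boundaryWindow_eq_image`).
Reference: Duminil-Copin–Smirnov, Ann. of Math. 175 (2012), §3 (boundary mid-edges of the strip).
-/

noncomputable section

open scoped BigOperators Topology Classical ComplexConjugate
open Filter Set Metric Complex
open Literature.Probability.LatticeModels Literature.Probability.RandomPlanarGeometry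
open Literature.Probability.RandomPlanarGeometry.SAW
open Literature.Barriers.CriticalPhenomena.HexGreen (nbrs mem_nbrs_iff)
open Literature.Barriers.CriticalPhenomena.HexKernel (vecA vecC unitE1)
open Summit.CriticalPhenomena.SAWScalingLimit.Theorems.PickHalfPlane
open Summit.CriticalPhenomena.SAWScalingLimit.Theorems.DecoherenceSynthesis (norm_hexMidpoint_sub_hexCenter_le)
open Summit.CriticalPhenomena.SAWScalingLimit.Theorems.ObservableToSLE.FloorRatio (dist_smul_mesh
  dist_hexCenter_hexMidpoint_le)
open Summit.CriticalPhenomena.SAWScalingLimit.Cruxes.DefectDecoherence.TipMartingaleDepthInduction.WallExitTwoPoint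
  (dist_hexCenter_le_one_of_adj)

namespace Summit.CriticalPhenomena.SAWScalingLimit.Theorems.PolygonParitySqueeze.GateDbar

/-! ### 1. Floor darts of the gate row -/

/-- The face below the up face `(k, m)` is one of its three neighbours. [folklore] -/
theorem floorDart_mem_nbrs (k m : ℤ) :
    (((![k, m - 1] : Site 2)), (1 : Fin 2)) ∈ nbrs (((![k, m] : Site 2)), (0 : Fin 2)) :=
  (mem_nbrs_iff _ _).2 (GateMass.adj_floorEdge' k m).symm

/-- **The floor dart points straight down**: `mid(e_k) − c_{(k,m,0)} = c/2 = −i/(2√3)` for every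
floor dart of a row. [folklore] -/
theorem hexMidpoint_floorDart_sub_center (k m : ℤ) :
    hexMidpoint s((((![k, m] : Site 2)), (0 : Fin 2)), (((![k, m - 1] : Site 2)), (1 : Fin 2))) -
        hexCenter (((![k, m] : Site 2)), (0 : Fin 2)) = vecC / 2 := by
  have h := (LocalL1.hexCenter_sub_up (![k, m] : Site 2)).2.2
  rw [show (![k, m] : Site 2) - unitE1 = ![k, m - 1] from GateMass.vec_sub_single_one k m] at h
  rw [hexMidpoint_mk]
  linear_combination h / 2

/-- `3c = 1 − 2ζ = −i√3`. [folklore] -/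
theorem three_mul_vecC : (3 : ℂ) * vecC = -(I * (Real.sqrt 3 : ℂ)) := by
  have hz : triZeta = (1 / 2 : ℂ) + ((Real.sqrt 3 / 2 : ℝ) : ℂ) * I := by
    apply Complex.ext
    · simp [triZeta_re]
    · simp [triZeta_im]
  simp only [vecC, vecA]
  rw [hz]
  push_cast
  ring

/-- `‖3c‖ = √3`. [folklore] -/
theorem norm_three_mul_vecC : ‖(3 : ℂ) * vecC‖ = Real.sqrt 3 := by
  rw [three_mul_vecC, norm_neg, norm_mul, Complex.norm_I, one_mul, Complex.norm_real,
    Real.norm_of_nonneg (Real.sqrt_nonneg 3)]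

/-- Floor mid-edges of one row are horizontal translates: `mid e_j = mid e_k + (j − k)`. [folklore] -/
theorem hexMidpoint_floorEdge_eq_add (j k m : ℤ) :
    hexMidpoint s((((![j, m - 1] : Site 2)), (1 : Fin 2)), ((![j, m] : Site 2), (0 : Fin 2))) =
      hexMidpoint s((((![k, m - 1] : Site 2)), (1 : Fin 2)), ((![k, m] : Site 2), (0 : Fin 2))) +
        ((j : ℂ) - (k : ℂ)) := by
  apply Complex.ext
  · rw [Complex.add_re, GateMass.re_hexMidpoint_floorEdge', GateMass.re_hexMidpoint_floorEdge',
      Complex.sub_re, Complex.intCast_re, Complex.intCast_re]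
    ring
  · rw [Complex.add_im, GateMass.im_hexMidpoint_floorEdge', GateMass.im_hexMidpoint_floorEdge',
      Complex.sub_im, Complex.intCast_im, Complex.intCast_im, sub_zero, add_zero]

/-- **The window of columns is an interval**: if the scaled midpoints of the floor darts of the
columns `k₁ ≤ k₂` lie in a ball, so do those of all columns in between (they lie on one horizontal
segment; balls are convex). [folklore] -/
theorem mem_window_between {m : ℤ} {δ r : ℝ} {c : ℂ} {k₁ k₂ j : ℤ} (hj₁ : k₁ ≤ j) (hj₂ : j ≤ k₂)
    (h₁ : (δ : ℂ) * hexMidpoint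
      s((((![k₁, m - 1] : Site 2)), (1 : Fin 2)), ((![k₁, m] : Site 2), (0 : Fin 2))) ∈ ball c r)
    (h₂ : (δ : ℂ) * hexMidpoint
      s((((![k₂, m - 1] : Site 2)), (1 : Fin 2)), ((![k₂, m] : Site 2), (0 : Fin 2))) ∈ ball c r) :
    (δ : ℂ) * hexMidpoint
      s((((![j, m - 1] : Site 2)), (1 : Fin 2)), ((![j, m] : Site 2), (0 : Fin 2))) ∈ ball c r := by
  rcases eq_or_lt_of_le (hj₁.trans hj₂) with heq | hlt
  · have : j = k₁ := le_antisymm (heq ▸ hj₂) hj₁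
    rw [this]; exact h₁
  have hd : (0 : ℝ) < (k₂ : ℝ) - k₁ := by
    have : (k₁ : ℝ) < k₂ := by exact_mod_cast hlt
    linarith
  have hd' : ((k₂ : ℂ) - (k₁ : ℂ)) ≠ 0 := sub_ne_zero.2 (by exact_mod_cast hlt.ne')
  set a : ℝ := ((k₂ : ℝ) - j) / ((k₂ : ℝ) - k₁) with ha
  set b : ℝ := ((j : ℝ) - k₁) / ((k₂ : ℝ) - k₁) with hb
  have ha0 : 0 ≤ a := div_nonneg (sub_nonneg.2 (by exact_mod_cast hj₂)) hd.le
  have hb0 : 0 ≤ b := div_nonneg (sub_nonneg.2 (by exact_mod_cast hj₁)) hd.le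
  have hab : a + b = 1 := by
    rw [ha, hb, ← add_div, div_eq_one_iff_eq hd.ne']; ring
  have hmem := convex_ball c r h₁ h₂ ha0 hb0 hab
  have hb' : (b : ℂ) * ((k₂ : ℂ) - (k₁ : ℂ)) = (j : ℂ) - (k₁ : ℂ) := by
    rw [hb]; push_cast; exact div_mul_cancel₀ _ hd'
  have hab' : (a : ℂ) + (b : ℂ) = 1 := by exact_mod_cast hab
  have e : a • ((δ : ℂ) * hexMidpoint
      s((((![k₁, m - 1] : Site 2)), (1 : Fin 2)), ((![k₁, m] : Site 2), (0 : Fin 2)))) +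
      b • ((δ : ℂ) * hexMidpoint
        s((((![k₂, m - 1] : Site 2)), (1 : Fin 2)), ((![k₂, m] : Site 2), (0 : Fin 2)))) =
      (δ : ℂ) * hexMidpoint
        s((((![j, m - 1] : Site 2)), (1 : Fin 2)), ((![j, m] : Site 2), (0 : Fin 2))) := by
    rw [hexMidpoint_floorEdge_eq_add j k₁ m, hexMidpoint_floorEdge_eq_add k₂ k₁ m, Complex.real_smul,
      Complex.real_smul]
    linear_combination ((δ : ℂ) * hexMidpoint
      s((((![k₁, m - 1] : Site 2)), (1 : Fin 2)), ((![k₁, m] : Site 2), (0 : Fin 2)))) * hab' +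
      (δ : ℂ) * hb'
  rw [← e]; exact hmem

/-! ### 2. The dart sum is a sum over the window of columns -/

/-- **Dart sums over the gate window.** Under the pin at `c` (radius `ρ`, `ρ/4 + δ/2 < ρ`), a
function of darts `(v ∈ Λ, t ∉ Λ, t ∼ v)` that vanishes unless the scaled midpoint lies in
`B(c, ρ/4)` sums, over all darts of `Λ`, to its sum over the floor darts `((k,m,0),(k,m-1,1))` of the
columns `k` of the window `{k | δ·mid e_k ∈ B(c, ρ/4)}`. [cite: DuminilCopinSmirnov2012, §3 (the boundary part α of the strip)] -/
theorem dartSum_eq_finsum_window {Λ : Finset HexVertex} {m : ℤ} {δ ρ : ℝ} {c : ℂ} (hδ : 0 ≤ δ)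
    (hpin : ∀ y : HexVertex, (δ : ℂ) * hexCenter y ∈ ball c ρ → (y ∈ Λ ↔ m ≤ y.1 1))
    (hρδ : ρ / 4 + δ / 2 < ρ) (G : HexVertex → HexVertex → ℂ)
    (hG : ∀ v t : HexVertex, hexGraph.Adj v t → v ∈ Λ → t ∉ Λ →
      (δ : ℂ) * hexMidpoint s(v, t) ∉ ball c (ρ / 4) → G v t = 0) :
    ∑ v ∈ Λ, ∑ t ∈ (nbrs v).filter (· ∉ Λ), G v t =
      ∑ᶠ k ∈ {k : ℤ | (δ : ℂ) * hexMidpoint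
          s((((![k, m - 1] : Site 2)), (1 : Fin 2)), ((![k, m] : Site 2), (0 : Fin 2))) ∈ ball c (ρ / 4)},
        G (((![k, m] : Site 2)), (0 : Fin 2)) (((![k, m - 1] : Site 2)), (1 : Fin 2)) := by
  classical
  have hS : ∀ z ∈ ball c (ρ / 4), dist z c + δ / 2 < ρ := fun z hz => by
    have := mem_ball.1 hz; linarith
  set Kw : Set ℤ := {k : ℤ | (δ : ℂ) * hexMidpoint
    s((((![k, m - 1] : Site 2)), (1 : Fin 2)), ((![k, m] : Site 2), (0 : Fin 2))) ∈ ball c (ρ / 4)} with hKw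
  have hKf : Kw.Finite := GateMass.finite_intWindow hδ hpin hS
  -- pinned faces of a window column
  have hup : ∀ k ∈ Kw, ((((![k, m] : Site 2)), (0 : Fin 2)) : HexVertex) ∈ Λ := fun k hk =>
    (hpin _ (GateMass.smul_hexCenter_mem_ball hδ (GateMass.floorEdge_mem_edgeSet k m)
      (Sym2.mem_mk_right _ _) (hS _ hk))).2 (by simp)
  have hdown : ∀ k ∈ Kw, ((((![k, m - 1] : Site 2)), (1 : Fin 2)) : HexVertex) ∉ Λ := fun k hk h => by
    have := (hpin _ (GateMass.smul_hexCenter_mem_ball hδ (GateMass.floorEdge_mem_edgeSet k m)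
      (Sym2.mem_mk_left _ _) (hS _ hk))).1 h
    simp at this
  -- the window darts as an image inside the sigma-finset of all darts
  set ι : ℤ → (Σ _ : HexVertex, HexVertex) := fun k =>
    ⟨(((![k, m] : Site 2)), (0 : Fin 2)), (((![k, m - 1] : Site 2)), (1 : Fin 2))⟩ with hι
  have hιinj : Set.InjOn ι ↑hKf.toFinset := by
    intro k _ k' _ h
    have h1 := congrArg (fun x : (Σ _ : HexVertex, HexVertex) => x.1.1 0) h
    simpa [hι] using h1
  have hsub : hKf.toFinset.image ι ⊆ Λ.sigma (fun v => (nbrs v).filter (· ∉ Λ)) := by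
    intro x hx
    obtain ⟨k, hk, rfl⟩ := Finset.mem_image.1 hx
    have hk' : k ∈ Kw := hKf.mem_toFinset.1 hk
    exact Finset.mem_sigma.2 ⟨hup k hk', Finset.mem_filter.2 ⟨floorDart_mem_nbrs k m, hdown k hk'⟩⟩
  have hzero : ∀ x ∈ Λ.sigma (fun v => (nbrs v).filter (· ∉ Λ)), x ∉ hKf.toFinset.image ι →
      G x.1 x.2 = 0 := by
    rintro ⟨v, t⟩ hx hnot
    obtain ⟨hv, ht⟩ := Finset.mem_sigma.1 hx
    obtain ⟨htn, htΛ⟩ := Finset.mem_filter.1 ht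
    have hadj : hexGraph.Adj v t := (mem_nbrs_iff _ _).1 htn
    refine hG v t hadj hv htΛ fun hball => hnot ?_
    -- a dart with scaled midpoint in the quarter ball is a window dart
    have hbd : s(v, t) ∈ {e : Sym2 HexVertex | e ∈ hexDomainBoundary Λ ∧
        (δ : ℂ) * hexMidpoint e ∈ ball c (ρ / 4)} :=
      ⟨⟨(SimpleGraph.mem_edgeSet hexGraph).2 hadj, t, v, Sym2.eq_swap, hv, htΛ⟩, hball⟩
    rw [GateMass.boundaryWindow_eq_image hδ hpin hS] at hbd
    obtain ⟨k, hk, hke⟩ := hbd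
    have hvt : v = (((![k, m] : Site 2)), (0 : Fin 2)) ∧ t = (((![k, m - 1] : Site 2)), (1 : Fin 2)) := by
      rcases Sym2.eq_iff.1 hke.symm with ⟨h1, h2⟩ | ⟨h1, h2⟩
      · exact absurd (h1 ▸ hv) (hdown k hk)
      · exact ⟨h1, h2⟩
    refine Finset.mem_image.2 ⟨k, hKf.mem_toFinset.2 hk, ?_⟩
    rw [hvt.1, hvt.2]
  calc ∑ v ∈ Λ, ∑ t ∈ (nbrs v).filter (· ∉ Λ), G v t
      = ∑ x ∈ Λ.sigma (fun v => (nbrs v).filter (· ∉ Λ)), G x.1 x.2 := Finset.sum_sigma' _ _ _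
    _ = ∑ x ∈ hKf.toFinset.image ι, G x.1 x.2 := (Finset.sum_subset hsub hzero).symm
    _ = ∑ k ∈ hKf.toFinset, G (ι k).1 (ι k).2 := Finset.sum_image hιinj
    _ = ∑ᶠ k ∈ Kw, G (((![k, m] : Site 2)), (0 : Fin 2)) (((![k, m - 1] : Site 2)), (1 : Fin 2)) := by
        rw [finsum_mem_eq_finite_toFinset_sum _ hKf]

/-! ### 3. Between two window darts the floor is flat and pinned -/

/-- **Flat pinned floor between two window darts.** Under the pin at `c` (radius `ρ`,
`ρ/4 + 2δ ≤ ρ`), if the floor darts of the columns `k₁ ≤ k₂` have scaled midpoints in `B(c, ρ/4)`,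
then for every column in between the up face `(j,m,0)` and the down face `(j,m,1)` lie in `Λ` while
the face `(j,m-1,1)` below does not. [cite: DuminilCopinSmirnov2012, §3 (the boundary part α of the strip)] -/
theorem floor_between {Λ : Finset HexVertex} {m : ℤ} {δ ρ : ℝ} {c : ℂ} (hδ : 0 ≤ δ)
    (hpin : ∀ y : HexVertex, (δ : ℂ) * hexCenter y ∈ ball c ρ → (y ∈ Λ ↔ m ≤ y.1 1))
    (hρδ : ρ / 4 + 2 * δ ≤ ρ) {k₁ k₂ : ℤ}
    (h₁ : (δ : ℂ) * hexMidpoint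
      s((((![k₁, m - 1] : Site 2)), (1 : Fin 2)), ((![k₁, m] : Site 2), (0 : Fin 2))) ∈ ball c (ρ / 4))
    (h₂ : (δ : ℂ) * hexMidpoint
      s((((![k₂, m - 1] : Site 2)), (1 : Fin 2)), ((![k₂, m] : Site 2), (0 : Fin 2))) ∈ ball c (ρ / 4)) :
    ∀ j : ℤ, k₁ ≤ j → j ≤ k₂ → ((![j, m], 0) : HexVertex) ∈ Λ ∧
      ((![j, m - 1], 1) : HexVertex) ∉ Λ ∧ (j < k₂ → ((![j, m], 1) : HexVertex) ∈ Λ) := by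
  intro j hj₁ hj₂
  have hj := mem_window_between hj₁ hj₂ h₁ h₂
  have hS : dist ((δ : ℂ) * hexMidpoint
      s((((![j, m - 1] : Site 2)), (1 : Fin 2)), ((![j, m] : Site 2), (0 : Fin 2)))) c + δ / 2 < ρ := by
    have := mem_ball.1 hj; linarith
  have hup : (δ : ℂ) * hexCenter ((![j, m], 0) : HexVertex) ∈ ball c ρ :=
    GateMass.smul_hexCenter_mem_ball hδ (GateMass.floorEdge_mem_edgeSet j m) (Sym2.mem_mk_right _ _) hS
  have hbelow : (δ : ℂ) * hexCenter ((![j, m - 1], 1) : HexVertex) ∈ ball c ρ :=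
    GateMass.smul_hexCenter_mem_ball hδ (GateMass.floorEdge_mem_edgeSet j m) (Sym2.mem_mk_left _ _) hS
  refine ⟨(hpin _ hup).2 (by simp), fun h => ?_, fun _ => ?_⟩
  · have := (hpin _ hbelow).1 h
    simp at this
  · -- the down face `(j, m, 1)` is adjacent to the up face, hence pinned too
    have hadj : hexGraph.Adj ((![j, m], 0) : HexVertex) ((![j, m], 1) : HexVertex) := by
      rw [hexGraph_adj_iff_coord]; simp
    have h1 : dist ((δ : ℂ) * hexCenter ((![j, m], 1) : HexVertex))
        ((δ : ℂ) * hexCenter ((![j, m], 0) : HexVertex)) ≤ δ := by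
      rw [dist_smul_mesh hδ]
      exact (mul_le_mul_of_nonneg_left (dist_hexCenter_le_one_of_adj hadj) hδ).trans (by linarith)
    have h3 : dist ((δ : ℂ) * hexCenter ((![j, m], 0) : HexVertex)) ((δ : ℂ) * hexMidpoint
        s((((![j, m - 1] : Site 2)), (1 : Fin 2)), ((![j, m] : Site 2), (0 : Fin 2)))) ≤ δ / 2 := by
      rw [dist_smul_mesh hδ]
      have := dist_hexCenter_hexMidpoint_le (GateMass.floorEdge_mem_edgeSet j m) (Sym2.mem_mk_right
        (((![j, m - 1] : Site 2)), (1 : Fin 2)) (((![j, m] : Site 2)), (0 : Fin 2)))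
      nlinarith
    have hdown : (δ : ℂ) * hexCenter ((![j, m], 1) : HexVertex) ∈ ball c ρ := by
      rw [mem_ball]
      have hjlt := mem_ball.1 hj
      have t1 := dist_triangle ((δ : ℂ) * hexCenter ((![j, m], 1) : HexVertex))
        ((δ : ℂ) * hexCenter ((![j, m], 0) : HexVertex)) c
      have t2 := dist_triangle ((δ : ℂ) * hexCenter ((![j, m], 0) : HexVertex)) ((δ : ℂ) * hexMidpoint
        s((((![j, m - 1] : Site 2)), (1 : Fin 2)), ((![j, m] : Site 2), (0 : Fin 2)))) c
      linarith
    exact (hpin _ hdown).2 (by simp)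

/-! ### Registered form (sub-goal of `stub_gateDbarLimit`) -/

/-- **Registered sub-goal `gateDbar_dartWindow`** (crux item stmt-CriticalPhenomena-14004, line
`polygon-parity-squeeze`, stub `stub_gateDbarLimit`, mechanism (C)): registry form (one `∀`-term) of
`dartSum_eq_finsum_window`. [cite: DuminilCopinSmirnov2012, §3 (the boundary part α of the strip)] -/
theorem gateDbar_dartWindow : ∀ (Λ : Finset HexVertex) (m : ℤ) (δ ρ : ℝ) (c : ℂ) (G : HexVertex → HexVertex → ℂ), 0 ≤ δ → (∀ y : HexVertex, (δ : ℂ) * hexCenter y ∈ Metric.ball c ρ → (y ∈ Λ ↔ m ≤ y.1 1)) → ρ / 4 + δ / 2 < ρ → (∀ v t : HexVertex, hexGraph.Adj v t → v ∈ Λ → t ∉ Λ → (δ : ℂ) * hexMidpoint s(v, t) ∉ Metric.ball c (ρ / 4) → G v t = 0) → ∑ v ∈ Λ, ∑ t ∈ (Literature.Barriers.CriticalPhenomena.HexGreen.nbrs v).filter (· ∉ Λ), G v t = ∑ᶠ k ∈ {k : ℤ | (δ : ℂ) * hexMidpoint s((((![k, m - 1] : Site 2)), (1 : Fin 2)), ((![k,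 m] : Site 2), (0 : Fin 2))) ∈ Metric.ball c (ρ / 4)}, G (((![k, m] : Site 2)), (0 : Fin 2)) (((![k, m - 1] : Site 2)), (1 : Fin 2)) :=
  fun _ _ _ _ _ G hδ hpin hρδ hG => dartSum_eq_finsum_window hδ hpin hρδ G hG

end Summit.CriticalPhenomena.SAWScalingLimit.Theorems.PolygonParitySqueeze.GateDbar

end
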